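import Literature.MathematicalPhysics.QuantumLattice.DuhamelTwoPointProofs
import Literature.MathematicalPhysics.QuantumLattice.FermionQuasiFree
import Mathlib.Analysis.SpecialFunctions.Integrals.Basic
import HarnessLib

/-!
# The imaginary-time Dyson equation of the thermal one-body propagator and the stability of its decay

For square complex matrices `h₀` (free one-body operator) and `V` (one-body perturbation), both
Hermitian, `H = h₀ + V`, `β ≥ 0`, the thermal (KMS) one-body kernel

  `Γ_X(τ) = e^{-τX} (1 + e^{-βX})⁻¹`,   `Γ_X(0) + Γ_X(β) = 1`,

satisfies on `0 ≤ τ ≤ β` the **imaginary-time Dyson equation**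

  `Γ_H(τ) = Γ_{h₀}(τ) - ∫₀^τ Γ_{h₀}(τ-s) V Γ_H(s) ds + ∫_τ^β Γ_{h₀}(τ-s+β) V Γ_H(s) ds`

(the antiperiodic convolution `Γ_H = Γ₀ - Γ₀ ⋆ V Γ_H`; in Matsubara space the resolvent identity
`(iω-H)⁻¹ = (iω-h₀)⁻¹ + (iω-h₀)⁻¹ V (iω-H)⁻¹`). PROVED here ALGEBRAICALLY from two instances of the
fundamental theorem of calculus for `s ↦ e^{(s-c)h₀} e^{-sH}` (`c = τ` on `[0, τ]`, `c = τ + β` on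
`[τ, β]`), multiplied by `(1 + e^{-βh₀})⁻¹` on the left and `(1 + e^{-βH})⁻¹` on the right — no
Matsubara sums, no uniqueness theorem for ODEs. Consequence (**stability of the decay of the thermal
propagator under small one-body perturbations**, the input of every expansion around a perturbed /
sourced / counter-termed free Hamiltonian): if the entries of `Γ_{h₀}(τ)` are dominated by positive
weights `w i j` for all `τ ∈ [0, β]`, and `w` is sub-convolutive through `|V|`,
`Σ_{k,l} w i k |V k l| w l j ≤ c · w i j`, with `θ = βc < 1`, then

  `|Γ_H(τ) i j| ≤ w i j / (1 - θ)`   for all `τ ∈ [0, β]`, `i`, `j`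

(`norm_thermalKernel_apply_le_of_subconvolutive`): a bootstrap on the maximal ratio
`M = max |Γ_H(τ) i j| / w i j`, `M ≤ 1 + θM`, with no series expansion.

* `hasDerivAt_exp_sub_smul_mul_exp_neg_smul`, `integral_exp_sub_smul_mul_mul_exp_neg_smul` — the FTC
  identity `∫_a^b e^{(s-c)h₀} V e^{-sH} ds = e^{(a-c)h₀}e^{-aH} - e^{(b-c)h₀}e^{-bH}`;
* `isUnit_det_one_add_exp_smul`, `inv_one_add_exp_smul_mul_exp_smul_comm` — invertibility of
  `1 + e^{bX}` for Hermitian `X` and commutation of its inverse with `e^{tX}`;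
* **`thermalKernel_dyson`** — the Dyson equation;
* `norm_integral_apply_le`, `norm_mul_mul_apply_le` — entrywise bounds for integrals and triple products;
* **`norm_thermalKernel_apply_le_of_subconvolutive`** — the stability theorem.

Everything is PROVED; no definition and no named fact.

## References

* A. L. Fetter, J. D. Walecka, *Quantum Theory of Many-Particle Systems* (1971), §24–25 (the
  temperature Green's function, its equation of motion and Dyson's equation). [cite: FetterWalecka1971, §25]
* O. Bratteli, D. W. Robinson, *Operator Algebras and QSM II*, 2nd ed. (1997), §5.4.1 (perturbation
  of KMS states; Duhamel/Dyson expansions). [cite: BratteliRobinsonII1997, §5.4.1]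
* G. Benfatto, A. Giuliani, V. Mastropietro, Ann. Henri Poincaré 7 (2006) 809–898, §2.1 (1.4) (the
  free thermal propagator of the expansion). [cite: BenfattoGiulianiMastropietro2006, §2.1]
-/

noncomputable section

open scoped Matrix.Norms.L2Operator ComplexOrder
open Finset MeasureTheory intervalIntegral Filter Topology NormedSpace Set

namespace Matrix

variable {m : Type*} [LinearOrder m] [Fintype m]

/-! ### The fundamental-theorem-of-calculus identity -/

/-- The derivative of `s ↦ e^{(s-c)h₀} e^{-s(h₀+V)}` is `-e^{(s-c)h₀} V e^{-s(h₀+V)}`. [folklore] -/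
theorem hasDerivAt_exp_sub_smul_mul_exp_neg_smul (h₀ V : Matrix m m ℂ) (c s : ℝ) :
    HasDerivAt (fun u : ℝ => exp ((u - c) • h₀) * exp ((-u) • (h₀ + V)))
      (-(exp ((s - c) • h₀) * V * exp ((-s) • (h₀ + V)))) s := by
  have h1 : HasDerivAt (fun u : ℝ => exp ((u - c) • h₀)) (exp ((s - c) • h₀) * h₀) s := by
    have h := (hasDerivAt_exp_smul_const h₀ (s - c)).scomp s
      ((hasDerivAt_id s).sub (hasDerivAt_const s c))
    simpa [Function.comp_def] using h
  have h2 : HasDerivAt (fun u : ℝ => exp ((-u) • (h₀ + V))) (-((h₀ + V) * exp ((-s) • (h₀ + V)))) s := by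
    have h := (hasDerivAt_exp_smul_const' (h₀ + V) (-s)).scomp s (hasDerivAt_neg s)
    simpa [Function.comp_def] using h
  refine (h1.mul h2).congr_deriv ?_
  simp only [mul_add, add_mul, mul_neg, mul_assoc]
  abel

/-- The integrand `s ↦ e^{(s-c)h₀} V e^{-sH}` is continuous. [folklore] -/
theorem continuous_exp_sub_smul_mul_mul_exp_neg_smul (h₀ V H : Matrix m m ℂ) (c : ℝ) :
    Continuous fun u : ℝ => exp ((u - c) • h₀) * V * exp ((-u) • H) := by
  letI : NormedAlgebra ℚ (Matrix m m ℂ) := .restrictScalars ℚ ℂ _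
  fun_prop

/-- **FTC identity**: `∫_a^b e^{(s-c)h₀} V e^{-s(h₀+V)} ds = e^{(a-c)h₀}e^{-a(h₀+V)} - e^{(b-c)h₀}e^{-b(h₀+V)}`.
[folklore] -/
theorem integral_exp_sub_smul_mul_mul_exp_neg_smul (h₀ V : Matrix m m ℂ) (c a b : ℝ) :
    ∫ u in a..b, exp ((u - c) • h₀) * V * exp ((-u) • (h₀ + V)) =
      exp ((a - c) • h₀) * exp ((-a) • (h₀ + V)) - exp ((b - c) • h₀) * exp ((-b) • (h₀ + V)) := by
  have hcont : Continuous fun u : ℝ => -(exp ((u - c) • h₀) * V * exp ((-u) • (h₀ + V))) :=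
    (continuous_exp_sub_smul_mul_mul_exp_neg_smul h₀ V (h₀ + V) c).neg
  have h := intervalIntegral.integral_eq_sub_of_hasDerivAt
    (fun u _ => hasDerivAt_exp_sub_smul_mul_exp_neg_smul h₀ V c u) (hcont.intervalIntegrable a b)
  rw [intervalIntegral.integral_neg, neg_eq_iff_eq_neg, neg_sub] at h
  exact h

/-! ### Invertibility of `1 + e^{bX}` and commutation -/

/-- For Hermitian `X` and real `b`, `1 + e^{bX}` is invertible. [folklore] -/
theorem isUnit_det_one_add_exp_smul {X : Matrix m m ℂ} (hX : X.IsHermitian) (b : ℝ) :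
    IsUnit (1 + exp (b • X)).det := by
  have h := ((Literature.MathematicalPhysics.QuantumLattice.posDef_one_add_exp_smul hX b).isUnit).map
    Matrix.detMonoidHom
  rwa [Complex.coe_smul] at h

/-- `e^{tX}` commutes with `(1 + e^{bX})⁻¹` (Hermitian `X`). [folklore] -/
theorem inv_one_add_exp_smul_mul_exp_smul_comm {X : Matrix m m ℂ} (hX : X.IsHermitian) (b t : ℝ) :
    (1 + exp (b • X))⁻¹ * exp (t • X) = exp (t • X) * (1 + exp (b • X))⁻¹ := by
  have hU := isUnit_det_one_add_exp_smul hX b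
  have hcomm : exp (t • X) * (1 + exp (b • X)) = (1 + exp (b • X)) * exp (t • X) := by
    rw [mul_add, add_mul, mul_one, one_mul,
      Matrix.exp_add_of_commute _ _ (((Commute.refl X).smul_left t).smul_right b) |>.symm.trans
        ((add_comm (t • X) (b • X)) ▸ (Matrix.exp_add_of_commute _ _
          (((Commute.refl X).smul_left b).smul_right t)))]
  calc (1 + exp (b • X))⁻¹ * exp (t • X)
      = (1 + exp (b • X))⁻¹ * exp (t • X) * ((1 + exp (b • X)) * (1 + exp (b • X))⁻¹) := by
        rw [Matrix.mul_nonsing_inv _ hU, mul_one]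
    _ = (1 + exp (b • X))⁻¹ * (exp (t • X) * (1 + exp (b • X))) * (1 + exp (b • X))⁻¹ := by
        simp only [mul_assoc]
    _ = (1 + exp (b • X))⁻¹ * ((1 + exp (b • X)) * exp (t • X)) * (1 + exp (b • X))⁻¹ := by
        rw [hcomm]
    _ = exp (t • X) * (1 + exp (b • X))⁻¹ := by
        rw [← mul_assoc, Matrix.nonsing_inv_mul _ hU, one_mul]

/-! ### The Dyson equation -/

/-- Pulling constant matrices out of an interval integral: `∫ A f B = A (∫ f) B`. [folklore] -/
theorem integral_const_mul_mul_const (A B : Matrix m m ℂ) {f : ℝ → Matrix m m ℂ} (hf : Continuous f)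
    (a b : ℝ) :
    ∫ u in a..b, A * f u * B = A * (∫ u in a..b, f u) * B := by
  set L : Matrix m m ℂ →L[ℝ] Matrix m m ℂ :=
    (ContinuousLinearMap.mulLeftRight ℂ (Matrix m m ℂ) A B).restrictScalars ℝ with hL
  have hLapply : ∀ X : Matrix m m ℂ, L X = A * X * B := fun X => rfl
  have hfun : (fun u => A * f u * B) = fun u => L (f u) := funext fun u => (hLapply (f u)).symm
  rw [hfun, L.intervalIntegral_comp_comm (hf.intervalIntegrable a b), hLapply]

/-- **The imaginary-time Dyson equation of the thermal one-body kernel.** For Hermitian `h₀`, `V`,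
`H = h₀ + V` and real `β, τ`,
`e^{-τH}(1+e^{-βH})⁻¹ = e^{-τh₀}(1+e^{-βh₀})⁻¹ - ∫₀^τ e^{-(τ-s)h₀}(1+e^{-βh₀})⁻¹ V e^{-sH}(1+e^{-βH})⁻¹ ds`
`  + ∫_τ^β e^{-(τ-s+β)h₀}(1+e^{-βh₀})⁻¹ V e^{-sH}(1+e^{-βH})⁻¹ ds`
(an identity for ALL real `β, τ`; for `0 ≤ τ ≤ β` every kernel argument lies in `[0, β]`).
[cite: FetterWalecka1971, §25] -/
theorem thermalKernel_dyson {h₀ V : Matrix m m ℂ} (hh₀ : h₀.IsHermitian) (hV : V.IsHermitian) (β τ : ℝ) :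
    exp ((-τ) • (h₀ + V)) * (1 + exp ((-β) • (h₀ + V)))⁻¹ =
      exp ((-τ) • h₀) * (1 + exp ((-β) • h₀))⁻¹
        - (∫ s in (0:ℝ)..τ, exp ((-(τ - s)) • h₀) * (1 + exp ((-β) • h₀))⁻¹ * V *
            (exp ((-s) • (h₀ + V)) * (1 + exp ((-β) • (h₀ + V)))⁻¹))
        + (∫ s in τ..β, exp ((-(τ - s + β)) • h₀) * (1 + exp ((-β) • h₀))⁻¹ * V *
            (exp ((-s) • (h₀ + V)) * (1 + exp ((-β) • (h₀ + V)))⁻¹)) := by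
  have hH : (h₀ + V).IsHermitian := hh₀.add hV
  set F₀ : Matrix m m ℂ := (1 + exp ((-β) • h₀))⁻¹ with hF₀
  set F : Matrix m m ℂ := (1 + exp ((-β) • (h₀ + V)))⁻¹ with hF
  have hU₀ := isUnit_det_one_add_exp_smul hh₀ (-β)
  have hU := isUnit_det_one_add_exp_smul hH (-β)
  have hF₀l : F₀ * (1 + exp ((-β) • h₀)) = 1 := Matrix.nonsing_inv_mul _ hU₀
  have hFr : (1 + exp ((-β) • (h₀ + V))) * F = 1 := Matrix.mul_nonsing_inv _ hU
  have hcomm₀ : ∀ t : ℝ, exp (t • h₀) * F₀ = F₀ * exp (t • h₀) := fun t =>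
    (inv_one_add_exp_smul_mul_exp_smul_comm hh₀ (-β) t).symm
  -- the integrands in the form `F₀ (e^{(s-c)h₀} V e^{-sH}) F`
  have hint : ∀ (c s : ℝ), exp ((-(c - s)) • h₀) * F₀ * V * (exp ((-s) • (h₀ + V)) * F) =
      F₀ * (exp ((s - c) • h₀) * V * exp ((-s) • (h₀ + V))) * F := by
    intro c s
    rw [show -(c - s) = s - c by ring, hcomm₀]
    simp only [mul_assoc]
  have hint₁ : (fun s : ℝ => exp ((-(τ - s)) • h₀) * F₀ * V * (exp ((-s) • (h₀ + V)) * F)) =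
      fun s => F₀ * (exp ((s - τ) • h₀) * V * exp ((-s) • (h₀ + V))) * F :=
    funext fun s => hint τ s
  have hint₂ : (fun s : ℝ => exp ((-(τ - s + β)) • h₀) * F₀ * V * (exp ((-s) • (h₀ + V)) * F)) =
      fun s => F₀ * (exp ((s - (τ + β)) • h₀) * V * exp ((-s) • (h₀ + V))) * F := by
    funext s
    rw [show τ - s + β = (τ + β) - s by ring]
    exact hint (τ + β) s
  rw [hint₁, hint₂,
    integral_const_mul_mul_const F₀ F (continuous_exp_sub_smul_mul_mul_exp_neg_smul h₀ V (h₀ + V) τ),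
    integral_const_mul_mul_const F₀ F
      (continuous_exp_sub_smul_mul_mul_exp_neg_smul h₀ V (h₀ + V) (τ + β)),
    integral_exp_sub_smul_mul_mul_exp_neg_smul, integral_exp_sub_smul_mul_mul_exp_neg_smul]
  -- everything is `F₀ · (⋯) · F`
  have hL : exp ((-τ) • (h₀ + V)) * F = F₀ * ((1 + exp ((-β) • h₀)) * exp ((-τ) • (h₀ + V))) * F := by
    rw [← mul_assoc F₀, hF₀l, one_mul]
  have h1 : exp ((-τ) • h₀) * F₀ = F₀ * (exp ((-τ) • h₀) * (1 + exp ((-β) • (h₀ + V)))) * F := by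
    rw [hcomm₀, mul_assoc F₀, mul_assoc (exp ((-τ) • h₀)), hFr, mul_one]
  rw [hL, h1]
  simp only [zero_sub, sub_self, neg_zero, zero_smul, exp_zero, one_mul, mul_one,
    show β - (τ + β) = -τ by ring, show τ - (τ + β) = -β by ring]
  noncomm_ring

/-! ### Entrywise bounds -/

/-- Entries commute with interval integrals, hence `‖(∫ f) i j‖ ≤ C |b - a|` if `‖f(s) i j‖ ≤ C`.
[folklore] -/
theorem norm_integral_apply_le {f : ℝ → Matrix m m ℂ} (hf : Continuous f) {a b C : ℝ}
    (i j : m) (hC : ∀ s ∈ Set.uIoc a b, ‖f s i j‖ ≤ C) :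
    ‖(∫ s in a..b, f s) i j‖ ≤ C * |b - a| := by
  set L : Matrix m m ℂ →L[ℝ] ℂ :=
    LinearMap.toContinuousLinearMap ((Matrix.entryLinearMap ℂ ℂ i j).restrictScalars ℝ) with hL
  have h1 : (∫ s in a..b, f s) i j = ∫ s in a..b, f s i j := by
    show L (∫ s in a..b, f s) = ∫ s in a..b, L (f s)
    exact (L.intervalIntegral_comp_comm (hf.intervalIntegrable a b)).symm
  rw [h1]
  exact intervalIntegral.norm_integral_le_of_norm_le_const hC

omit [LinearOrder m] in
/-- `|(A V B) i j| ≤ Σ_{k,l} |A i k| |V k l| |B l j|`. [folklore] -/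
theorem norm_mul_mul_apply_le (A V B : Matrix m m ℂ) (i j : m) :
    ‖(A * V * B) i j‖ ≤ ∑ k, ∑ l, ‖A i k‖ * ‖V k l‖ * ‖B l j‖ := by
  rw [Finset.sum_comm]
  simp only [Matrix.mul_apply, Finset.sum_mul]
  refine (norm_sum_le _ _).trans (sum_le_sum fun l _ => ?_)
  refine (norm_sum_le _ _).trans (sum_le_sum fun k _ => ?_)
  exact le_of_eq (by rw [norm_mul, norm_mul])

/-! ### Stability of the decay under small one-body perturbations -/

/-- **Stability of the decay of the thermal propagator under a small one-body perturbation.** Let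
`h₀`, `V` be Hermitian, `0 ≤ β`, and `w i j > 0` weights dominating the entries of the free kernel,
`‖(e^{-τh₀}(1+e^{-βh₀})⁻¹) i j‖ ≤ w i j` for all `τ ∈ [0, β]`, sub-convolutive through `|V|`:
`Σ_{k,l} w i k ‖V k l‖ w l j ≤ c · w i j`. If `θ = βc < 1` then for all `τ ∈ [0, β]`, `i`, `j`,
`‖(e^{-τ(h₀+V)}(1+e^{-β(h₀+V)})⁻¹) i j‖ ≤ w i j / (1 - θ)` — a bootstrap on the maximal ratio through
the Dyson equation (`thermalKernel_dyson`), no series expansion. [cite: FetterWalecka1971, §25] -/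
theorem norm_thermalKernel_apply_le_of_subconvolutive {h₀ V : Matrix m m ℂ} (hh₀ : h₀.IsHermitian)
    (hV : V.IsHermitian) {β : ℝ} (hβ : 0 ≤ β) (w : m → m → ℝ) (hw : ∀ i j, 0 < w i j)
    (hΓ₀ : ∀ τ ∈ Icc (0:ℝ) β, ∀ i j, ‖(exp ((-τ) • h₀) * (1 + exp ((-β) • h₀))⁻¹) i j‖ ≤ w i j)
    {c : ℝ} (hconv : ∀ i j, ∑ k, ∑ l, w i k * ‖V k l‖ * w l j ≤ c * w i j)
    (hθ : β * c < 1) :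
    ∀ τ ∈ Icc (0:ℝ) β, ∀ i j,
      ‖(exp ((-τ) • (h₀ + V)) * (1 + exp ((-β) • (h₀ + V)))⁻¹) i j‖ ≤ w i j / (1 - β * c) := by
  rcases isEmpty_or_nonempty m with hm | hm
  · intro τ _ i; exact isEmptyElim i
  letI : NormedAlgebra ℚ (Matrix m m ℂ) := .restrictScalars ℚ ℂ _
  set Γ : ℝ → Matrix m m ℂ := fun τ => exp ((-τ) • (h₀ + V)) * (1 + exp ((-β) • (h₀ + V)))⁻¹
    with hΓ
  have hθ1 : 0 < 1 - β * c := by linarith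
  -- continuity of the entries of `Γ` in `τ`
  have hΓc : Continuous Γ := by
    simp only [hΓ]
    fun_prop
  have hentry : ∀ i j, Continuous fun τ => ‖Γ τ i j‖ / w i j := by
    intro i j
    set L : Matrix m m ℂ →L[ℝ] ℂ :=
      LinearMap.toContinuousLinearMap ((Matrix.entryLinearMap ℂ ℂ i j).restrictScalars ℝ) with hL
    have hLapply : ∀ X : Matrix m m ℂ, L X = X i j := fun X => rfl
    have h1 : Continuous fun τ => L (Γ τ) := L.continuous.comp hΓc
    simp only [hLapply] at h1
    exact (h1.norm).div_const _
  -- maximisers of the ratios on `[0, β]`, and the maximal ratio `M`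
  have hmax : ∀ i j, ∃ τ₀ ∈ Icc (0:ℝ) β, IsMaxOn (fun τ => ‖Γ τ i j‖ / w i j) (Icc 0 β) τ₀ :=
    fun i j => isCompact_Icc.exists_isMaxOn (nonempty_Icc.2 hβ) (hentry i j).continuousOn
  choose τ₀ hτ₀mem hτ₀max using hmax
  set f : m × m → ℝ := fun p => ‖Γ (τ₀ p.1 p.2) p.1 p.2‖ / w p.1 p.2 with hf
  set M : ℝ := (Finset.univ : Finset (m × m)).sup' Finset.univ_nonempty f with hM
  have hM0 : 0 ≤ M := by
    obtain ⟨i⟩ := hm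
    have h0 : 0 ≤ f (i, i) := by
      show 0 ≤ ‖Γ (τ₀ i i) i i‖ / w i i
      exact div_nonneg (norm_nonneg _) (hw i i).le
    exact h0.trans (Finset.le_sup' f (Finset.mem_univ (i, i)))
  have hle : ∀ τ ∈ Icc (0:ℝ) β, ∀ i j, ‖Γ τ i j‖ ≤ M * w i j := by
    intro τ hτ i j
    have h1 : ‖Γ τ i j‖ / w i j ≤ f (i, j) := hτ₀max i j hτ
    have h2 : f (i, j) ≤ M := Finset.le_sup' f (Finset.mem_univ (i, j))
    rw [div_le_iff₀ (hw i j)] at h1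
    exact h1.trans (mul_le_mul_of_nonneg_right h2 (hw i j).le)
  -- the bound on the kernel of one integral term
  have hker : ∀ (u s : ℝ), u ∈ Icc (0:ℝ) β → s ∈ Icc (0:ℝ) β → ∀ i j,
      ‖(exp ((-u) • h₀) * (1 + exp ((-β) • h₀))⁻¹ * V * Γ s) i j‖ ≤ c * M * w i j := by
    intro u s hu hs i j
    refine (norm_mul_mul_apply_le _ _ _ i j).trans ?_
    calc ∑ k, ∑ l, ‖(exp ((-u) • h₀) * (1 + exp ((-β) • h₀))⁻¹) i k‖ * ‖V k l‖ * ‖Γ s l j‖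
        ≤ ∑ k, ∑ l, w i k * ‖V k l‖ * (M * w l j) := by
          refine sum_le_sum fun k _ => sum_le_sum fun l _ => ?_
          have ha := hΓ₀ u hu i k
          have hb := hle s hs l j
          have h0 : 0 ≤ ‖V k l‖ := norm_nonneg _
          calc ‖(exp ((-u) • h₀) * (1 + exp ((-β) • h₀))⁻¹) i k‖ * ‖V k l‖ * ‖Γ s l j‖
              ≤ w i k * ‖V k l‖ * ‖Γ s l j‖ := by gcongr
            _ ≤ w i k * ‖V k l‖ * (M * w l j) := by
                refine mul_le_mul_of_nonneg_left hb ?_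
                exact mul_nonneg (hw i k).le h0
      _ = M * ∑ k, ∑ l, w i k * ‖V k l‖ * w l j := by
          rw [Finset.mul_sum]
          refine sum_congr rfl fun k _ => ?_
          rw [Finset.mul_sum]
          refine sum_congr rfl fun l _ => ?_
          ring
      _ ≤ M * (c * w i j) := mul_le_mul_of_nonneg_left (hconv i j) hM0
      _ = c * M * w i j := by ring
  -- the key inequality: `‖Γ τ i j‖ ≤ w i j (1 + β c M)` on `[0, β]`
  have hkey : ∀ τ ∈ Icc (0:ℝ) β, ∀ i j, ‖Γ τ i j‖ ≤ w i j * (1 + β * (c * M)) := by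
    intro τ hτ i j
    have hcont₁ : Continuous fun s : ℝ => exp ((-(τ - s)) • h₀) * (1 + exp ((-β) • h₀))⁻¹ * V * Γ s := by
      simp only [hΓ]; fun_prop
    have hcont₂ : Continuous fun s : ℝ =>
        exp ((-(τ - s + β)) • h₀) * (1 + exp ((-β) • h₀))⁻¹ * V * Γ s := by
      simp only [hΓ]; fun_prop
    have hI₁ : ‖(∫ s in (0:ℝ)..τ, exp ((-(τ - s)) • h₀) * (1 + exp ((-β) • h₀))⁻¹ * V * Γ s) i j‖ ≤
        c * M * w i j * |τ - 0| := by
      refine norm_integral_apply_le hcont₁ i j fun s hs => ?_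
      rw [uIoc_of_le hτ.1] at hs
      exact hker (τ - s) s ⟨by linarith [hs.2], by linarith [hs.1, hτ.2]⟩
        ⟨hs.1.le, hs.2.trans hτ.2⟩ i j
    have hI₂ : ‖(∫ s in τ..β, exp ((-(τ - s + β)) • h₀) * (1 + exp ((-β) • h₀))⁻¹ * V * Γ s) i j‖ ≤
        c * M * w i j * |β - τ| := by
      refine norm_integral_apply_le hcont₂ i j fun s hs => ?_
      rw [uIoc_of_le hτ.2] at hs
      exact hker (τ - s + β) s ⟨by linarith [hs.2, hτ.1], by linarith [hs.1]⟩
        ⟨hτ.1.trans hs.1.le, hs.2⟩ i j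
    have hdys : Γ τ = exp ((-τ) • h₀) * (1 + exp ((-β) • h₀))⁻¹
        - (∫ s in (0:ℝ)..τ, exp ((-(τ - s)) • h₀) * (1 + exp ((-β) • h₀))⁻¹ * V * Γ s)
        + (∫ s in τ..β, exp ((-(τ - s + β)) • h₀) * (1 + exp ((-β) • h₀))⁻¹ * V * Γ s) :=
      thermalKernel_dyson hh₀ hV β τ
    rw [hdys, Matrix.add_apply, Matrix.sub_apply]
    have hsplit : ∀ (a b d : ℂ), ‖a - b + d‖ ≤ ‖a‖ + ‖b‖ + ‖d‖ := fun a b d =>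
      (norm_add_le _ _).trans (by linarith [norm_sub_le a b])
    refine (hsplit _ _ _).trans ?_
    rw [abs_of_nonneg (by linarith [hτ.1] : (0:ℝ) ≤ τ - 0)] at hI₁
    rw [abs_of_nonneg (by linarith [hτ.2] : (0:ℝ) ≤ β - τ)] at hI₂
    have h0 := hΓ₀ τ hτ i j
    linarith [hI₁, hI₂, h0]
  -- bootstrap: at the maximiser, `M ≤ 1 + β c M`
  have hMle : M ≤ 1 + β * (c * M) := by
    obtain ⟨p, -, hp⟩ := Finset.exists_mem_eq_sup' Finset.univ_nonempty f
    have hwpos := hw p.1 p.2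
    have hMw : M * w p.1 p.2 = ‖Γ (τ₀ p.1 p.2) p.1 p.2‖ := by
      rw [hM, hp]
      show ‖Γ (τ₀ p.1 p.2) p.1 p.2‖ / w p.1 p.2 * w p.1 p.2 = _
      exact div_mul_cancel₀ _ hwpos.ne'
    have hk := hkey (τ₀ p.1 p.2) (hτ₀mem p.1 p.2) p.1 p.2
    have hprod : M * w p.1 p.2 ≤ (1 + β * (c * M)) * w p.1 p.2 := by rw [hMw]; linarith
    exact le_of_mul_le_mul_right hprod hwpos
  have hMbound : M ≤ 1 / (1 - β * c) := by
    rw [le_div_iff₀ hθ1]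
    nlinarith
  -- conclusion
  intro τ hτ i j
  calc ‖(exp ((-τ) • (h₀ + V)) * (1 + exp ((-β) • (h₀ + V)))⁻¹) i j‖ = ‖Γ τ i j‖ := rfl
    _ ≤ M * w i j := hle τ hτ i j
    _ ≤ 1 / (1 - β * c) * w i j := mul_le_mul_of_nonneg_right hMbound (hw i j).le
    _ = w i j / (1 - β * c) := by ring

end Matrix
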